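import Summits.QuantumAdvantage.AdviceFreeQNC0.AffBells23NearPerfect
import Summits.QuantumAdvantage.AdviceFreeQNC0.AffBells23AntipodalSmall
import Summits.QuantumAdvantage.AdviceFreeQNC0.AffBells24ExposedSupport
import Summits.QuantumAdvantage.AdviceFreeQNC0.KernelFibrationMoves
import HarnessLib

/-!
# Sketch26 (planner qn-p1 g26, ROUND-25 §5): the FLIP-CUBE SIEVE for the (NP₀) rung — statements

(VERBATIM copy of `HOME/qa-qnc0-p1/exp26/Sketch26.lean` (sha16 `1f2d12ddb5549d15` at port time), authored by the planner
seat qn-p1 g26 — statements + the PROVED glue `noPerfect_of_isolable`, `noPerfect_of_refutable`, `noPerfectAffineBells3_of_S26`,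
`pigeonholeCover`; landed by the prover seat qn-prover-3 g14 (ask P-26).  Only this paragraph and two one-line docstrings are new, and the three
`native_decide` sanity `example`s of Q0 are dropped (see the note below); nothing else is changed.)

Cross-fibre tool for `AffBells23.NoPerfectAffineBells3` (no affine MOD₃ bell strategy `z_k(x) = [⟨β_k,x⟩ = c_k]` wins the
ring relation on every odd input).  Fibre coordinates: an odd input `x` has kernel line `J = kline x`; the COINS are the
zeros of `J` (`Z = zeros J`), the bits of `x` on `supp J` are forced (`Fib19.apply_eq_of_kline`).

* `TargetFormula` (Q0) — on the odd class, `Rel x z ⟺ #{b ∈ supp J : z_b} + N + Z + p ≡ 0 (mod 2)`, where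
  `p = #{i : J i = J (i+2) = false}` counts coin pairs at distance two.  (The win target is a QUADRATIC function of the
  coin set; checked below by `native_decide` for `N = 5, 6, 7`; exhaustive numerics `N ≤ 10`, exp26/sieve.py.)
* `CubeTarget` (Q1') — for a flip set `A` of `m ≥ 2` coin-creation moves (`Fib19.kline_create`: flipping `x` at `a-1, a+1`
  creates the coin `a`), pairwise at cyclic distance `≥ 3`, the targets of the `2^m` inputs `x_S = flipAt x (⋃_{a∈S} {a-1,a+1})`,
  `S ⊆ A`, sum to `0 (mod 2)` (the target is affine along spread-out creations).
* `CubeIdentity` (Q1) — for ANY strategy, `Σ_{S ⊆ A} #{active firing bells of x_S} ≡ Σ_{g ∈ Surv} (1 + [⟨β_g,x⟩ = c_g + D_g])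
  (mod 2)`: a row `g` that is BLIND to one creation `a ∈ A ∖ {g}` (`d g a = 0`, `d g a = β_{g,a-1}(1+x_{a-1}) + β_{g,a+1}(1+x_{a+1})`
  = the change of the form `⟨β_g,·⟩` under the move) cancels by the involution `S ↦ S △ {a}`; a row seeing every creation
  contributes `#{S ⊆ A∖g : ⟨β_g,x⟩ + Σ_{a∈S} d g a = c_g} ≡ [c_g - ⟨β_g,x⟩ + D_g ≠ 0]` (`AffBells24.nSub_mod_two`), `D_g = Σ_{a ∈ A∖g} d g a`.
* `CubeConstraint` (Q2) — hence a PERFECT strategy satisfies `Σ_{g ∈ Surv} (1 + [⟨β_g,x⟩ = c_g + D_g]) ≡ 0` for every odd `x`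
  and every admissible `A`, `|A| ≥ 2`: a constant relation among only `|Surv|` MOD₃ tests on the fibre of `x`.
* `SingleSurvivorCriterion` (Q3) — if some admissible `(x, A)` has exactly ONE surviving row `g` and `β_g` does not vanish on
  the coins of `x` (`Z ≥ 3`), then `(β, c)` loses on some odd input, for EVERY `c`.  (Two-coin flips inside the fibre,
  `Fib19.kline_flipPair`, make the lone test non-constant.)

Data (exp26/sieve.py): random β with no zero entry, N = 10..16: an isolating `(x, A)` with `|A| ≤ 3` exists in 80/80 samples;
uniformly random β: 61/80; the perfect strategies at N = 5, 6, 7 admit none (as they must).  Blind spots (no isolating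
configuration): COHERENT row systems — all rows `±` one common vector on each run of a common zero pattern (generalised frames;
half-lattice supports).  ROUND-25 §5 proposes the dichotomy `isolable ∨ coherent` + frame averaging as the (NP₀) architecture.
WHAT THIS IS NOT: statements (asks P-26a–c) + three `native_decide` sanity checks; no bound for any strategy; crux 22907 untouched.
-/

namespace Summit.QuantumAdvantage.AdviceFreeQNC0

namespace AffBells26

open Finset Literature.Computability.QuantumComplexity Literature.Computability.QuantumComplexity.RingHLF
open AffBells23 Fib19

/-! ### Q0 — the target in fibre coordinates -/

/-- Number of coin pairs at cyclic distance two: `#{i : J i = false ∧ J (i+2) = false}`. -/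
def pairs2 {N : ℕ} (J : Fin N → Bool) : ℕ :=
  (univ.filter fun i : Fin N => J i = false ∧ J (nxt (nxt i)) = false).card

/-- Number of ACTIVE positions (`kline x b = true`) at which the answer bit is set. -/
def activeOnes {N : ℕ} (x z : Fin N → Bool) : ℕ :=
  (univ.filter fun b : Fin N => kline x b = true ∧ z b = true).card

/-- **Q0 (target formula).** On the odd class the ring relation is the parity condition
`#{active b : z_b} + N + Z + p ≡ 0 (mod 2)`, `Z = zeros (kline x)`, `p = pairs2 (kline x)`. -/
def TargetFormula : Prop :=
  ∀ N : ℕ, 3 ≤ N → ∀ x : Fin N → Bool, IsOdd x → ∀ z : Fin N → Bool,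
    (RingHLF.Rel x z ↔ (activeOnes x z + N + zeros (kline x) + pairs2 (kline x)) % 2 = 0)

/-! Sanity checks of Q0 for `N = 5, 6, 7` (three `native_decide` examples in the planner's file) are OMITTED here
(compiler-trust axiom); `TargetFormula` is PROVED for all `N ≥ 3` in `AffBells26TargetFormula.lean`. -/

/-! ### Flip cubes -/

/-- The linear form of row `g` at `x`: `⟨β_g, x⟩ = Σ_{i : x i} β g i` (so `affBell β c x g = [form β x g = c g]`). -/
def form {N : ℕ} (β : Fin N → Fin N → ZMod 3) (x : Fin N → Bool) (g : Fin N) : ZMod 3 :=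
  ∑ i : Fin N, if x i then β g i else 0

/-- Change of `form β · g` under the coin-creation move at `a` (flip the bits `a-1`, `a+1` of `x`):
`d = β_{g,a-1}·(1 + x_{a-1}) + β_{g,a+1}·(1 + x_{a+1})` (a bit flipped `0 → 1` adds `β`, `1 → 0` adds `-β = 2β`). -/
def d {N : ℕ} (β : Fin N → Fin N → ZMod 3) (x : Fin N → Bool) (g a : Fin N) : ZMod 3 :=
  β g (prv a) * (if x (prv a) then 2 else 1) + β g (nxt a) * (if x (nxt a) then 2 else 1)

/-- The bits flipped by the creations in `S`: `⋃_{a ∈ S} {a-1, a+1}`. -/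
def flipSet {N : ℕ} (S : Finset (Fin N)) : Finset (Fin N) :=
  S.biUnion fun a => {prv a, nxt a}

/-- The input `x_S`: all creations `a ∈ S` applied to `x`. -/
def xS {N : ℕ} (x : Fin N → Bool) (S : Finset (Fin N)) : Fin N → Bool :=
  flipAt x (flipSet S)

/-- Admissible flip set for `x`: every `a ∈ A` and its two neighbours are ACTIVE (`kline x = true`; so the move at `a` is the
coin creation of `Fib19.kline_create`), and distinct members are at cyclic distance `≥ 3` (their flip pairs are disjoint and
not adjacent, so the moves commute and each row's form changes additively). -/
def Admissible {N : ℕ} (x : Fin N → Bool) (A : Finset (Fin N)) : Prop :=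
  (∀ a ∈ A, kline x (prv a) = true ∧ kline x a = true ∧ kline x (nxt a) = true) ∧
    ∀ a ∈ A, ∀ a' ∈ A, a ≠ a' → a' ≠ nxt a ∧ a' ≠ nxt (nxt a) ∧ a' ≠ prv a ∧ a' ≠ prv (prv a)

/-- Surviving rows of the cube `(x, A)`: ACTIVE rows `g` that see every creation `a ∈ A ∖ {g}` (`d β x g a ≠ 0`). -/
def Surv {N : ℕ} (β : Fin N → Fin N → ZMod 3) (x : Fin N → Bool) (A : Finset (Fin N)) : Finset (Fin N) :=
  univ.filter fun g : Fin N => kline x g = true ∧ ∀ a ∈ A.erase g, d β x g a ≠ 0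

/-- Total drift of a surviving row: `D_g = Σ_{a ∈ A ∖ g} d β x g a`. -/
def D {N : ℕ} (β : Fin N → Fin N → ZMod 3) (x : Fin N → Bool) (A : Finset (Fin N)) (g : Fin N) : ZMod 3 :=
  ∑ a ∈ A.erase g, d β x g a

/-- The survivors' side of the cube identity: `Σ_{g ∈ Surv} (1 + [form β x g = c g + D_g])`. -/
def survSum {N : ℕ} (β : Fin N → Fin N → ZMod 3) (c : Fin N → ZMod 3) (x : Fin N → Bool) (A : Finset (Fin N)) : ℕ :=
  ∑ g ∈ Surv β x A, (1 + if form β x g = c g + D β x A g then 1 else 0)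

/-- **Q1' (cube target).** Along an admissible cube with `|A| ≥ 2` the targets sum to zero:
`Σ_{S ⊆ A} (N + Z(x_S) + p(x_S)) ≡ 0 (mod 2)` (each creation adds one coin and `[a-2 coin] + [a+2 coin]` distance-two pairs:
affine in `S`). -/
def CubeTarget : Prop :=
  ∀ N : ℕ, 5 ≤ N → ∀ (x : Fin N → Bool) (A : Finset (Fin N)), IsOdd x → Admissible x A → 2 ≤ A.card →
    (∑ S ∈ A.powerset, (N + zeros (kline (xS x S)) + pairs2 (kline (xS x S)))) % 2 = 0

/-- **Q1 (cube identity)** — for EVERY affine bell strategy: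
`Σ_{S ⊆ A} #{active firing bells of x_S} ≡ Σ_{g ∈ Surv} (1 + [form β x g = c g + D_g]) (mod 2)`. -/
def CubeIdentity : Prop :=
  ∀ N : ℕ, 5 ≤ N → ∀ (β : Fin N → Fin N → ZMod 3) (c : Fin N → ZMod 3) (x : Fin N → Bool) (A : Finset (Fin N)),
    IsOdd x → Admissible x A → 2 ≤ A.card →
      (∑ S ∈ A.powerset, activeOnes (xS x S) (affBell β c (xS x S))) % 2 = survSum β c x A % 2

/-- **Q2 (cube constraint for perfect strategies).** `TargetFormula → CubeTarget → CubeIdentity →` : a strategy winning on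
every odd input has `survSum ≡ 0 (mod 2)` on every admissible cube with `|A| ≥ 2`. -/
def CubeConstraint : Prop :=
  ∀ N : ℕ, 5 ≤ N → ∀ (β : Fin N → Fin N → ZMod 3) (c : Fin N → ZMod 3),
    (∀ x : Fin N → Bool, IsOdd x → RingHLF.Rel x (affBell β c x)) →
      ∀ (x : Fin N → Bool) (A : Finset (Fin N)), IsOdd x → Admissible x A → 2 ≤ A.card → survSum β c x A % 2 = 0

/-- **Q3 (single-survivor criterion).** If an admissible cube `(x, A)`, `|A| ≥ 2`, has exactly one surviving row `g`, the fibre of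
`x` has `Z ≥ 3` coins and `β_g` is non-zero at some coin, then the strategy loses on some odd input — whatever `c` is. -/
def SingleSurvivorCriterion : Prop :=
  ∀ N : ℕ, 5 ≤ N → ∀ (β : Fin N → Fin N → ZMod 3) (c : Fin N → ZMod 3) (x : Fin N → Bool) (A : Finset (Fin N)) (g : Fin N),
    IsOdd x → Admissible x A → 2 ≤ A.card → Surv β x A = {g} → 3 ≤ zeros (kline x) →
      (∃ i : Fin N, kline x i = false ∧ β g i ≠ 0) →
        ∃ x' : Fin N → Bool, IsOdd x' ∧ ¬ RingHLF.Rel x' (affBell β c x')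

/-- Bookkeeping: Q2 from Q0, Q1', Q1 (the three parities add up). -/
def CubeConstraintOf : Prop := TargetFormula → CubeTarget → CubeIdentity → CubeConstraint

/-- Bookkeeping: Q3 from Q2 (apply Q2 at every point of the fibre of `x`; two-coin flips `Fib19.kline_flipPair` keep the fibre,
the cube data `Admissible / Surv / D` — which only read ACTIVE bits — and move `form β · g` by `±β_{g,i} ± β_{g,j}`; with three
coins and one non-zero `β_{g,i}` the lone test cannot be constant). -/
def SingleSurvivorOf : Prop := CubeConstraint → SingleSurvivorCriterion

/-- With Q3, (NP₀) for a given `N` reduces to: every `β` admits an isolating cube — the combinatorial half of ROUND-25 §5. -/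
def Isolable {N : ℕ} (β : Fin N → Fin N → ZMod 3) : Prop :=
  ∃ (x : Fin N → Bool) (A : Finset (Fin N)) (g : Fin N), IsOdd x ∧ Admissible x A ∧ 2 ≤ A.card ∧ Surv β x A = {g} ∧
    3 ≤ zeros (kline x) ∧ ∃ i : Fin N, kline x i = false ∧ β g i ≠ 0

/-- Q3 form of the sieve: an isolating cube for `β` refutes `(β, c)` for every `c`. -/
theorem noPerfect_of_isolable (h : SingleSurvivorCriterion) {N : ℕ} (hN : 5 ≤ N) (β : Fin N → Fin N → ZMod 3)
    (hβ : Isolable β) (c : Fin N → ZMod 3) : ∃ x : Fin N → Bool, IsOdd x ∧ ¬ RingHLF.Rel x (affBell β c x) := by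
  obtain ⟨x, A, g, hx, hA, hcard, hS, hZ, hi⟩ := hβ
  exact h N hN β c x A g hx hA hcard hS hZ hi

/-! ## The general refutation criterion, THEOREM S26 and the Pigeonhole Cover Lemma (ROUND-25 §5.2, §5.7) -/

/-- `β` is CUBE-REFUTABLE when for every offset vector `c` some admissible cube (`|A| ≥ 2`) has ODD survivors' sum.  The
computational "c-free criterion" of exp26d/sieve2.py certifies this by enumerating `c` on the ≤ s surviving rows only (`Surv`, `D`
read active bits, so they are constant on the fibre); `Isolable` is its one-survivor instance. -/
def CubeRefutable {N : ℕ} (β : Fin N → Fin N → ZMod 3) : Prop :=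
  ∀ c : Fin N → ZMod 3, ∃ (x : Fin N → Bool) (A : Finset (Fin N)), IsOdd x ∧ Admissible x A ∧ 2 ≤ A.card ∧ survSum β c x A % 2 = 1

/-- Q2 form of the sieve: a cube-refutable `β` loses on some odd input for every `c`. -/
theorem noPerfect_of_refutable (h : CubeConstraint) {N : ℕ} (hN : 5 ≤ N) (β : Fin N → Fin N → ZMod 3)
    (hβ : CubeRefutable β) (c : Fin N → ZMod 3) : ∃ x : Fin N → Bool, IsOdd x ∧ ¬ RingHLF.Rel x (affBell β c x) := by
  by_contra hcon
  push Not at hcon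
  obtain ⟨x, A, hx, hA, hcard, hodd⟩ := hβ c
  have h0 := h N hN β c hcon x A hx hA hcard
  omega

/-- **THEOREM S26** (CONJECTURE, ROUND-25 §5.4/§5.7; the combinatorial half of (NP₀) once Q0–Q2 are proved): every strategy
matrix of every large enough size is cube-refutable (creation cubes; the hop/length-4 version needs `CubeIdentity` for
`Fib19.kline_hop` windows and is what the data of §5.3 actually support for creation-immune lattice supports). -/
def CubeRefutableAll : Prop := ∃ N₀ : ℕ, ∀ N ≥ N₀, ∀ β : Fin N → Fin N → ZMod 3, CubeRefutable β

/-- Its DENSE case (no zero entry) — reduced by `pigeonholeCover` to the bookkeeping of O(log N) odd rows (§5.7); the class on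
which every earlier tool of the cell was powerless. -/
def CubeRefutableDense : Prop :=
  ∃ N₀ : ℕ, ∀ N ≥ N₀, ∀ β : Fin N → Fin N → ZMod 3, (∀ g i, β g i ≠ 0) → CubeRefutable β

/-- (NP₀) (`AffBells23.NoPerfectAffineBells3`, stated with `OddZeros`) from Q2 and S26. -/
theorem noPerfectAffineBells3_of_S26 (h : CubeConstraint) (hS : CubeRefutableAll) : NoPerfectAffineBells3 := by
  obtain ⟨N₀, hN₀⟩ := hS
  refine ⟨max N₀ 5, fun N hN β c => ?_⟩
  obtain ⟨x, hx, hrel⟩ := noPerfect_of_refutable h (le_of_max_le_right hN) β (hN₀ N (le_of_max_le_left hN) β) c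
  exact ⟨x, (isOdd_iff_oddZeros x).mp hx, hrel⟩

/-- **Two-survivor criterion** (ROUND-25 §5.2; to be proved, M−).  Exhaustive check (exp26, Z = 5; random Z = 6, 7): on a parity
class with `Z ≥ 5` coins two affine MOD₃ tests agree as Boolean functions only if their coin parts are ± each other or BOTH have
coin-support ≤ 1 (at Z = 3, 4 there are further coincidences, e.g. (1,2,2,0) ~ (1,0,2,1), so `5 ≤ Z` is needed).  Hence two surviving
rows, one of which has two non-zero coin entries, not ± each other on the coins, violate the cube constraint for every `c`. -/
def TwoSurvivorCriterion : Prop :=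
  ∀ N : ℕ, 5 ≤ N → ∀ (β : Fin N → Fin N → ZMod 3) (c : Fin N → ZMod 3) (x : Fin N → Bool) (A : Finset (Fin N)) (g h : Fin N),
    IsOdd x → Admissible x A → 2 ≤ A.card → g ≠ h → Surv β x A = {g, h} → 5 ≤ zeros (kline x) →
      (∃ i j : Fin N, i ≠ j ∧ kline x i = false ∧ kline x j = false ∧
          ((β g i ≠ 0 ∧ β g j ≠ 0) ∨ (β h i ≠ 0 ∧ β h j ≠ 0))) →
      (¬ ∀ i : Fin N, kline x i = false → β g i = β h i) → (¬ ∀ i : Fin N, kline x i = false → β g i = -β h i) →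
        ∃ x' : Fin N → Bool, IsOdd x' ∧ ¬ RingHLF.Rel x' (affBell β c x')

/-- **Pigeonhole Cover Lemma** (ROUND-25 §5.7, PROVED): rows `g ∈ G` with zero-free windows at `m` centres carry type words
`τ g : Fin m → Bool` (E/U); if `|G| < 2^m` some sign vector `q` kills every row of `G` — a row escapes `q` only if its type word is
the complement of `q`, and fewer than `2^m` words cannot exhaust the complements. -/
theorem pigeonholeCover {α : Type*} [DecidableEq α] (G : Finset α) (m : ℕ) (τ : α → Fin m → Bool)
    (hG : G.card < 2 ^ m) : ∃ q : Fin m → Bool, ∀ g ∈ G, ∃ j, τ g j = q j := by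
  classical
  have hlt : (G.image fun g => fun j => !τ g j).card < (Finset.univ : Finset (Fin m → Bool)).card := by
    calc (G.image fun g => fun j => !τ g j).card ≤ G.card := Finset.card_image_le
      _ < 2 ^ m := hG
      _ = (Finset.univ : Finset (Fin m → Bool)).card := by simp [Finset.card_univ]
  obtain ⟨q, -, hq⟩ := Finset.exists_mem_notMem_of_card_lt_card hlt
  refine ⟨q, fun g hg => ?_⟩
  by_contra hcon
  push Not at hcon
  apply hq
  refine Finset.mem_image.mpr ⟨g, hg, funext fun j => ?_⟩
  have hj := hcon j
  cases hτ : τ g j <;> cases hqj : q j <;> simp_all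

end AffBells26

end Summit.QuantumAdvantage.AdviceFreeQNC0
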